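import Mathlib
import Literature.NumberTheory.Irrationality.Lai2025TwoAdic.GeneralRationalFunctionB
import HarnessLib

/-!
# Lai 2025 (IJNT, `2`-adic zeta values), §6 for GENERAL `s`, part 1: the Leibniz expansion of
# `f^{(s)}`, `f(t) = (t+1)^{s+2}⋯(t+n)^{s+2}·∏_{k=0}^{n}(4t+4k+1)^{−(s+2)}`, and the regrouping of its terms into
# `n!^{2+j} binom(t+n,n)^{2+j} ∏_k ((k−1)!(n−k)! binom(t+k−1,k−1) binom(t+n,n−k))^{i_k}` — PROVED

Topic `Literature/NumberTheory/Irrationality/Lai2025TwoAdic`.  Source: L. Lai, *On the irrationality of certain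
`2`-adic zeta values*, Int. J. Number Theory (2025) = arXiv:2304.00816 [Lai2025TwoAdicZeta], §6, proofs of Lemmas 6.2
and 6.3 (held text `paper:arxiv-2304.00816`, chunks p0011–p0012, read on the page).  PROOF FILE (definitions with
bodies + theorems; no named fact, net debt 0); file 3a of the discharge of the tree's named fact
`PAdicZetaValues.lai2025TwoAdic_theorem13` for GENERAL `s` (pure `ℚ`-algebra; the `2`-adic valuation count of Lemma 6.3
is the sibling `GeneralTwoAdicValuation.lean`).

## Source, as printed ([Lai2025TwoAdicZeta, §6, proof of Lemma 6.2; «word-by-word the same» for Lemma 6.3])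

«Note that `B_n(t+¼) = 2^{(5s+10)n+2s+4}·f(t)`, where `f(t) = (t+1)^{s+2}(t+2)^{s+2}⋯(t+n)^{s+2}g(t)` and
`g(t) = ∏_{k=0}^{n}(4t+4k+1)^{−(s+2)}`. … We define the index set `I` by
`I = {(i_1,…,i_n,j) ∈ (ℤ_{≥0})^{n+1} | i_1+⋯+i_n+j = s}`.  Applying the Leibniz rule, we have
`f^{(s)}(t) = Σ_{(i_1,…,i_n,j)∈I} s!/(i_1!⋯i_n!j!) · ((t+1)^{s+2})^{(i_1)} ⋯ ((t+n)^{s+2})^{(i_n)} · g^{(j)}(t)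
 = Σ_{I} s! binom(s+2,i_1)⋯binom(s+2,i_n) · (t+1)^{s+2−i_1}⋯(t+n)^{s+2−i_n} · g^{(j)}(t)/j! = Σ_I f_{(i_1,…,i_n,j)}(t)`,
where `f_{(i_1,…,i_n,j)}(t) = s! binom(s+2,i_1)⋯binom(s+2,i_n) · g^{(j)}(t)/j! · n!^{2+j} binom(t+n,n)^{2+j}
× ∏_{k=1}^{n} ((k−1)!(n−k)! binom(t+k−1,k−1) binom(t+n,n−k))^{i_k}`.»

## What is formalised (all PROVED)

* `divDeriv_finset_prod` — the **Leibniz rule for divided derivatives of finite products**, multi-indices as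
  Mathlib's `Finset.piAntidiag`: `𝒟_r(∏_{a∈S}F_a)(x) = Σ_{κ ∈ S.piAntidiag r} ∏_a 𝒟_{κ_a}F_a(x)` (induction with
  `piAntidiag_cons`, the two-factor rule being the tree's `divDeriv_mul`); `divDeriv_add_const_pow`
  (`𝒟_i(t+c)^N = binom(N,i)(t+c)^{N−i}`), `divDeriv_inv_linear_four` (`𝒟_λ(4t+c)^{−1} = (−4)^λ(4t+c)^{−(λ+1)}`).
* `fcore s n` — `f` with `g` written as the product of the `(s+2)(n+1)` simple factors indexed by
  `invIdx s n = [0,n] × [0,s+1]`; `Bs_add_quarter_eq_fcore` (`B_n(x+¼) = 2^{(5s+10)n+2s+4}f(x)`, from the tree's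
  `Bs_add_quarter`).
* **(eqn_Sum)** `divDeriv_fcore` — `𝒟_s f(x) = Σ_{i≤s} [Σ_{ι ∈ [1,n].piAntidiag i} ∏_k binom(s+2,ι_k)(x+k)^{s+2−ι_k}] ·
  [Σ_{λ ∈ invIdx.piAntidiag (s−i)} ∏_α (−4)^{λ_α}(4x+4a+1)^{−(λ_α+1)}]` off the poles of `g` (the derivatives of `g` kept
  as the explicit multi-index sum instead of `g^{(j)}/j!`; `i = i_1+⋯+i_n`, `j = s − i`).
* **The regrouping** `prod_pow_sub_eq`: `∏_k (x+k)^{s+2−ι_k} = P(x)^{s+2−r}·∏_k W_k(x)^{ι_k}` for `Σι = r ≤ s+2`, with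
  `Pfun n = (t+1)⋯(t+n)`, `Wfun n k = P/(t+k)`; and at natural points `Pfun_natCast` (`P(m) = n!binom(m+n,n)`),
  `Wfun_natCast` (`W_k(m) = (k−1)!binom(m+k−1,k−1)·(n−k)!binom(m+n,n−k)`).

Cell zeta5-irr / pub-zeta5 (HONEST FRAMING: systematic search; no irrationality claim unless kernel-certified):
calculus bookkeeping for `2`-adic linear forms; nothing here bears on `ζ(5) ∈ ℝ`.
-/

noncomputable section

open Finset Filter Polynomial Literature.Analysis.Calculus
open scoped Nat Topology

namespace Literature.NumberTheory.Irrationality.Lai2025TwoAdic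

/-! ## §1. The Leibniz rule for divided derivatives of finite products (multi-indices `piAntidiag`) -/

/-- **Leibniz rule over a finite product**: `𝒟_r(∏_{a∈S} F_a)(x) = Σ_{κ ∈ S.piAntidiag r} ∏_{a∈S} 𝒟_{κ_a}F_a(x)` for smooth
factors («Applying the Leibniz rule, we have `f^{(s)}(t) = Σ_{(i_1,…,i_n,j) ∈ I} s!/(i_1!⋯i_n!j!) ((t+1)^{s+2})^{(i_1)} ⋯`»).
[cite: Lai2025TwoAdicZeta, Lemma 6.2/6.3 (proof, the display (eqn_Sum))] -/
theorem divDeriv_finset_prod {ι : Type*} [DecidableEq ι] (S : Finset ι) (F : ι → ℚ → ℚ) {x : ℚ}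
    (hF : ∀ a ∈ S, ContDiffAt ℚ (⊤ : ℕ∞) (F a) x) (r : ℕ) :
    divDeriv r (fun t => ∏ a ∈ S, F a t) x = ∑ κ ∈ S.piAntidiag r, ∏ a ∈ S, divDeriv (κ a) (F a) x := by
  induction S using Finset.cons_induction generalizing r with
  | empty =>
    simp only [prod_empty]
    rw [piAntidiag_empty]
    rcases r with _ | r
    · simp
    · rw [if_neg (Nat.succ_ne_zero r), sum_empty, divDeriv, iteratedDeriv_const, if_neg (Nat.succ_ne_zero r),
        zero_div]
  | cons a S ha ih =>
    have hFa : ContDiffAt ℚ r (F a) x := (hF a (mem_cons_self a S)).of_le (mod_cast le_top)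
    have hFS : ∀ b ∈ S, ContDiffAt ℚ (⊤ : ℕ∞) (F b) x := fun b hb => hF b (mem_cons_of_mem hb)
    have hPS : ContDiffAt ℚ r (fun t => ∏ b ∈ S, F b t) x :=
      (contDiffAt_prod fun b hb => hFS b hb).of_le (mod_cast le_top)
    simp only [prod_cons]
    rw [divDeriv_fun_mul hFa hPS, piAntidiag_cons, sum_disjiUnion, Nat.sum_antidiagonal_eq_sum_range_succ_mk]
    refine sum_congr rfl fun i _ => ?_
    rw [sum_map, ih hFS (r - i), mul_sum]
    refine sum_congr rfl fun κ hκ => ?_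
    have hκa : κ a = 0 := by
      have h := (mem_piAntidiag.1 hκ).2 a
      by_contra hne
      exact ha (h hne)
    simp only [addRightEmbedding_apply, Pi.add_apply, if_true, hκa, zero_add]
    congr 1
    exact prod_congr rfl fun b hb => by rw [if_neg (ne_of_mem_of_not_mem hb ha), add_zero]

/-- `𝒟_i[(t+c)^N](x) = binom(N,i)(x+c)^{N−i}`. [cite: Lai2025TwoAdicZeta, Lemma 6.2 (proof: "((t+k)^{s+2})^{(i_k)} … (s+2)!/(s+2−i_k)!")] -/
theorem divDeriv_add_const_pow (N i : ℕ) (c x : ℚ) :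
    divDeriv i (fun t : ℚ => (t + c) ^ N) x = (N.choose i : ℚ) * (x + c) ^ (N - i) := by
  rw [divDeriv, iteratedDeriv_comp_add_const i (fun t : ℚ => t ^ N) c]
  simp only
  rw [iteratedDeriv_pow, Nat.descFactorial_eq_factorial_mul_choose]
  have hi : (i ! : ℚ) ≠ 0 := by exact_mod_cast Nat.factorial_ne_zero i
  push_cast
  field_simp

/-- `𝒟_λ[(4t+c)^{−1}](x) = (−4)^λ (4x+c)^{−(λ+1)}` for `4x + c ≠ 0` (the factors of `g`).
[cite: Lai2025TwoAdicZeta, Lemma 6.3 (proof: g(t) = ∏(4t+4k+1)^{−(s+2)} and its derivatives g^{(j)}/j!)] -/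
theorem divDeriv_inv_linear_four (lam : ℕ) (c : ℚ) {x : ℚ} (hx : 4 * x + c ≠ 0) :
    divDeriv lam (fun t : ℚ => (4 * t + c)⁻¹) x = (-4) ^ lam * ((4 * x + c) ^ (lam + 1))⁻¹ := by
  have hx' : x + c / 4 ≠ 0 := by
    intro h; apply hx; linarith [h]
  have hfun : (fun t : ℚ => (4 * t + c)⁻¹) = fun t => (1 / 4 : ℚ) * (t + c / 4)⁻¹ := by
    funext t
    by_cases ht : 4 * t + c = 0
    · have : t + c / 4 = 0 := by linarith
      rw [ht, this]; simp
    · have : t + c / 4 ≠ 0 := fun h => ht (by linarith)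
      field_simp
  rw [hfun, divDeriv, iteratedDeriv_const_mul _ (contDiffAt_inv_add_const hx'), mul_div_assoc,
    show iteratedDeriv lam (fun t => (t + c / 4)⁻¹) x / (lam ! : ℚ) = divDeriv lam (fun t => (t + c / 4)⁻¹) x
      from rfl, divDeriv_inv_add_const lam hx']
  have h4 : x + c / 4 = (4 * x + c) * (1 / 4) := by ring
  rw [h4, mul_pow, one_div_pow, show (-4 : ℚ) ^ lam = (-1) ^ lam * 4 ^ lam by rw [← mul_pow]; norm_num]
  field_simp
  ring

/-! ## §2. The function `f(t) = ∏_{k=1}^{n}(t+k)^{s+2}·∏_{a=0}^{n}(4t+4a+1)^{−(s+2)}` and `B_n(x+¼) = 2^E f(x)` -/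

/-- The index set of the inverse factors: `(a, c) ∈ [0,n] × [0,s+1]` labels the `(s+2)(n+1)` simple factors
`(4t+4a+1)^{−1}` of `g`. [cite: Lai2025TwoAdicZeta, Lemma 6.3 (proof: g(t) = ∏_{k=0}^{n}(4t+4k+1)^{−(s+2)})] -/
def invIdx (s n : ℕ) : Finset (ℕ × ℕ) := range (n + 1) ×ˢ range (s + 2)

/-- `f(t) := ∏_{k=1}^{n}(t+k)^{s+2} · ∏_{(a,c)} (4t+4a+1)^{−1}` — the function `f` of §6 with `g` written as a product of
`(s+2)(n+1)` simple factors. [cite: Lai2025TwoAdicZeta, Lemma 6.3 (proof: f(t) = (t+1)^{s+2}⋯(t+n)^{s+2}g(t))] -/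
def fcore (s n : ℕ) (t : ℚ) : ℚ :=
  (∏ k ∈ Icc 1 n, (t + k) ^ (s + 2)) * ∏ α ∈ invIdx s n, (4 * t + 4 * (α.1 : ℚ) + 1)⁻¹

/-- `∏_{(a,c) ∈ invIdx} (4t+4a+1)^{−1} = (∏_{a≤n}(4t+4a+1))^{−(s+2)}`. [cite: Lai2025TwoAdicZeta, Lemma 6.3 (proof: g)] -/
theorem prod_invIdx_inv (s n : ℕ) (t : ℚ) :
    ∏ α ∈ invIdx s n, (4 * t + 4 * (α.1 : ℚ) + 1)⁻¹ = ((∏ a ∈ range (n + 1), (4 * t + 4 * (a : ℚ) + 1)) ^ (s + 2))⁻¹ := by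
  rw [invIdx, prod_product]
  have e : ∀ a ∈ range (n + 1), ∏ _c ∈ range (s + 2), (4 * t + 4 * ((a, _c).1 : ℚ) + 1)⁻¹ =
      ((4 * t + 4 * (a : ℚ) + 1) ^ (s + 2))⁻¹ := fun a _ => by
    simp only [prod_const, card_range, inv_pow]
  rw [prod_congr rfl e, prod_inv_distrib, prod_pow]

/-- `∏_{k ∈ [1,n]}(x+k) = ∏_{j<n}(x+1+j)`. [folklore] -/
private theorem prod_Icc_eq_prod_range (n : ℕ) (x : ℚ) :
    ∏ k ∈ Icc 1 n, (x + k) = ∏ j ∈ range n, (x + 1 + j) := by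
  rw [← Finset.Ico_add_one_right_eq_Icc, Finset.prod_Ico_eq_prod_range, Nat.add_sub_cancel]
  exact prod_congr rfl fun j _ => by push_cast; ring

/-- **`B_n(x + ¼) = 2^{(5s+10)n+2s+4} · f(x)`** for every rational `x` (tree `Bs_add_quarter`).
[cite: Lai2025TwoAdicZeta, Lemma 6.3 (proof: "B_n(t+¼) = 2^{(5s+10)n+2s+4}·f(t)")] -/
theorem Bs_add_quarter_eq_fcore (s n : ℕ) (x : ℚ) :
    Bs s n (x + 1 / 4) = (2 : ℚ) ^ ((5 * s + 10) * n + 2 * s + 4) * fcore s n x := by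
  rw [Bs_add_quarter, fcore, prod_invIdx_inv, ← prod_Icc_eq_prod_range, prod_pow, div_eq_mul_inv, mul_assoc]

/-! ## §3. The expansion of `𝒟_s f` by the Leibniz rule -/

/-- The polynomial part: `𝒟_i[∏_{k=1}^{n}(t+k)^{s+2}](x) = Σ_{ι ∈ [1,n].piAntidiag i} ∏_k binom(s+2,ι_k)(x+k)^{s+2−ι_k}`.
[cite: Lai2025TwoAdicZeta, Lemma 6.2/6.3 (proof, (eqn_Sum): the factors s!binom(s+2,i_1)⋯binom(s+2,i_n)(t+1)^{s+2−i_1}⋯)] -/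
theorem divDeriv_prod_pow (s n i : ℕ) (x : ℚ) :
    divDeriv i (fun t : ℚ => ∏ k ∈ Icc 1 n, (t + k) ^ (s + 2)) x =
      ∑ ι ∈ (Icc 1 n).piAntidiag i, ∏ k ∈ Icc 1 n, (((s + 2).choose (ι k) : ℕ) : ℚ) * (x + k) ^ (s + 2 - ι k) := by
  rw [divDeriv_finset_prod (Icc 1 n) (fun k t => (t + (k : ℚ)) ^ (s + 2)) (fun k _ => by fun_prop) i]
  refine sum_congr rfl fun ι _ => prod_congr rfl fun k _ => ?_
  exact divDeriv_add_const_pow (s + 2) (ι k) k x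

/-- The inverse part: `𝒟_q[∏_{α}(4t+4a+1)^{−1}](x) = Σ_{λ ∈ invIdx.piAntidiag q} ∏_α (−4)^{λ_α}(4x+4a+1)^{−(λ_α+1)}`
(off the poles). [cite: Lai2025TwoAdicZeta, Lemma 6.3 (proof: the derivatives g^{(j)}(t)/j!)] -/
theorem divDeriv_prod_inv (s n q : ℕ) {x : ℚ} (hx : ∀ a ∈ range (n + 1), 4 * x + 4 * (a : ℚ) + 1 ≠ 0) :
    divDeriv q (fun t : ℚ => ∏ α ∈ invIdx s n, (4 * t + 4 * (α.1 : ℚ) + 1)⁻¹) x =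
      ∑ lam ∈ (invIdx s n).piAntidiag q, ∏ α ∈ invIdx s n,
        (-4 : ℚ) ^ (lam α) * ((4 * x + 4 * (α.1 : ℚ) + 1) ^ (lam α + 1))⁻¹ := by
  have hx' : ∀ α ∈ invIdx s n, 4 * x + 4 * (α.1 : ℚ) + 1 ≠ 0 := fun α hα =>
    hx α.1 (mem_product.1 hα).1
  have hsm : ∀ α ∈ invIdx s n, ContDiffAt ℚ (⊤ : ℕ∞) (fun t : ℚ => (4 * t + 4 * (α.1 : ℚ) + 1)⁻¹) x := by
    intro α hα
    exact ((contDiffAt_const.mul contDiffAt_id).add contDiffAt_const |>.add contDiffAt_const).inv (hx' α hα)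
  rw [divDeriv_finset_prod (invIdx s n) (fun α t => (4 * t + 4 * (α.1 : ℚ) + 1)⁻¹) hsm q]
  refine sum_congr rfl fun lam _ => prod_congr rfl fun α hα => ?_
  have h := divDeriv_inv_linear_four (lam α) (4 * (α.1 : ℚ) + 1) (x := x) (by rw [← add_assoc]; exact hx' α hα)
  simp only [← add_assoc] at h ⊢
  exact h

/-- **The Leibniz expansion of `𝒟_s f`** (off the poles of `g`):
`𝒟_s f(x) = Σ_{i ≤ s} [Σ_{ι ∈ [1,n].piAntidiag i} ∏_k binom(s+2,ι_k)(x+k)^{s+2−ι_k}] ·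
[Σ_{λ ∈ invIdx.piAntidiag (s−i)} ∏_α (−4)^{λ_α}(4x+4a+1)^{−(λ_α+1)}]`.
[cite: Lai2025TwoAdicZeta, Lemma 6.2/6.3 (proof, (eqn_Sum) and the definition of f_{(i_1,…,i_n,j)})] -/
theorem divDeriv_fcore (s n : ℕ) {x : ℚ} (hx : ∀ a ∈ range (n + 1), 4 * x + 4 * (a : ℚ) + 1 ≠ 0) :
    divDeriv s (fcore s n) x = ∑ i ∈ range (s + 1),
      (∑ ι ∈ (Icc 1 n).piAntidiag i, ∏ k ∈ Icc 1 n, (((s + 2).choose (ι k) : ℕ) : ℚ) * (x + k) ^ (s + 2 - ι k)) *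
      (∑ lam ∈ (invIdx s n).piAntidiag (s - i), ∏ α ∈ invIdx s n,
        (-4 : ℚ) ^ (lam α) * ((4 * x + 4 * (α.1 : ℚ) + 1) ^ (lam α + 1))⁻¹) := by
  have hx' : ∀ α ∈ invIdx s n, 4 * x + 4 * (α.1 : ℚ) + 1 ≠ 0 := fun α hα =>
    hx α.1 (mem_product.1 hα).1
  have h1 : ContDiffAt ℚ s (fun t : ℚ => ∏ k ∈ Icc 1 n, (t + k) ^ (s + 2)) x := by fun_prop
  have h2 : ContDiffAt ℚ s (fun t : ℚ => ∏ α ∈ invIdx s n, (4 * t + 4 * (α.1 : ℚ) + 1)⁻¹) x := by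
    refine contDiffAt_prod fun α hα => ?_
    exact ((contDiffAt_const.mul contDiffAt_id).add contDiffAt_const |>.add contDiffAt_const).inv (hx' α hα)
  have hf : fcore s n = fun t : ℚ => (∏ k ∈ Icc 1 n, (t + (k : ℚ)) ^ (s + 2)) *
      ∏ α ∈ invIdx s n, (4 * t + 4 * (α.1 : ℚ) + 1)⁻¹ := rfl
  rw [hf, divDeriv_fun_mul h1 h2]
  refine sum_congr rfl fun i _ => ?_
  rw [divDeriv_prod_pow, divDeriv_prod_inv s n (s - i) hx]

/-! ## §4. Regrouping the polynomial part into the atoms `P = n!·binom(t+n,n)` and `W_k = P/(t+k)` -/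

/-- `P(x) := ∏_{k=1}^{n}(x+k)` and `W_k(x) := ∏_{k' ≠ k}(x+k')` (`1 ≤ k ≤ n`). [cite: Lai2025TwoAdicZeta, Lemma 6.2 (proof: the display for f_{(i_1,…,i_n,j)})] -/
def Pfun (n : ℕ) (x : ℚ) : ℚ := ∏ k ∈ Icc 1 n, (x + k)

/-- `W_k(x) := ∏_{k' ∈ [1,n], k' ≠ k}(x+k')`. [cite: Lai2025TwoAdicZeta, Lemma 6.2 (proof)] -/
def Wfun (n k : ℕ) (x : ℚ) : ℚ := ∏ k' ∈ (Icc 1 n).erase k, (x + k')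

/-- `W_k(x)·(x+k) = P(x)` for `k ∈ [1,n]`. [cite: Lai2025TwoAdicZeta, Lemma 6.2 (proof)] -/
theorem Wfun_mul (n : ℕ) {k : ℕ} (hk : k ∈ Icc 1 n) (x : ℚ) : Wfun n k x * (x + k) = Pfun n x := by
  rw [Wfun, Pfun, prod_erase_mul _ _ hk]

/-- **The regrouping identity**: for a multi-index `ι` on `[1,n]` with `Σ_k ι_k = r ≤ s+2` and `x` with all `x + k ≠ 0`,
`∏_k (x+k)^{s+2−ι_k} = P(x)^{s+2−r} · ∏_k W_k(x)^{ι_k}` — the step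
«`(t+1)^{s+2−i_1}⋯(t+n)^{s+2−i_n} = n!^{2+j}binom(t+n,n)^{2+j}∏_k((k−1)!(n−k)!binom(t+k−1,k−1)binom(t+n,n−k))^{i_k}`».
[cite: Lai2025TwoAdicZeta, Lemma 6.2 (proof, the display for f_{(i_1,…,i_n,j)})] -/
theorem prod_pow_sub_eq (s n : ℕ) {r : ℕ} (hr : r ≤ s + 2) {ι : ℕ → ℕ} (hι : ι ∈ (Icc 1 n).piAntidiag r)
    {x : ℚ} (hx : ∀ k ∈ Icc 1 n, x + k ≠ 0) :
    ∏ k ∈ Icc 1 n, (x + k) ^ (s + 2 - ι k) = Pfun n x ^ (s + 2 - r) * ∏ k ∈ Icc 1 n, Wfun n k x ^ ι k := by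
  have hsum : ∑ k ∈ Icc 1 n, ι k = r := (mem_piAntidiag.1 hι).1
  have hle : ∀ k ∈ Icc 1 n, ι k ≤ r := fun k hk => by
    rw [← hsum]; exact single_le_sum (fun _ _ => Nat.zero_le _) hk
  have hD : ∏ k ∈ Icc 1 n, (x + k) ^ ι k ≠ 0 := prod_ne_zero_iff.2 fun k hk => pow_ne_zero _ (hx k hk)
  -- both sides times `∏_k (x+k)^{ι_k}` give `P^{s+2}`
  have h1 : (∏ k ∈ Icc 1 n, (x + k) ^ (s + 2 - ι k)) * ∏ k ∈ Icc 1 n, (x + k) ^ ι k = Pfun n x ^ (s + 2) := by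
    rw [← prod_mul_distrib, Pfun, ← prod_pow]
    refine prod_congr rfl fun k hk => ?_
    rw [← pow_add, Nat.sub_add_cancel ((hle k hk).trans hr)]
  have h2 : (Pfun n x ^ (s + 2 - r) * ∏ k ∈ Icc 1 n, Wfun n k x ^ ι k) * ∏ k ∈ Icc 1 n, (x + k) ^ ι k =
      Pfun n x ^ (s + 2) := by
    rw [mul_assoc, ← prod_mul_distrib]
    have : ∏ k ∈ Icc 1 n, (Wfun n k x ^ ι k * (x + k) ^ ι k) = Pfun n x ^ r := by
      rw [← hsum, ← prod_pow_eq_pow_sum]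
      exact prod_congr rfl fun k hk => by rw [← mul_pow, Wfun_mul n hk]
    rw [this, ← pow_add, Nat.sub_add_cancel hr]
  exact mul_right_cancel₀ hD (h1.trans h2.symm)

/-- `(m+1)(m+2)⋯(m+n) = n!·binom(m+n,n)` in the `Icc` indexing: `P(m) = n!·binom(m+n,n)` for natural `m`.
[cite: Lai2025TwoAdicZeta, Lemma 6.2 (proof: "(t+1)⋯(t+n) = n! binom(t+n,n)")] -/
theorem Pfun_natCast (n m : ℕ) : Pfun n m = (n ! : ℚ) * ((m + n).choose n : ℚ) := by
  rw [Pfun, prod_Icc_eq_prod_range, prod_range_add_one_add]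

/-- `W_k(m) = (k−1)!·binom(m+k−1,k−1) · (n−k)!·binom(m+n,n−k)` for natural `m` and `1 ≤ k ≤ n`
(split `∏_{k'≠k}` at `k`). [cite: Lai2025TwoAdicZeta, Lemma 6.2 (proof: "(k−1)!(n−k)!binom(t+k−1,k−1)binom(t+n,n−k)")] -/
theorem Wfun_natCast (n m : ℕ) {k : ℕ} (hk : k ∈ Icc 1 n) :
    Wfun n k m = ((k - 1)! : ℚ) * ((m + (k - 1)).choose (k - 1) : ℚ) *
      (((n - k)! : ℚ) * ((m + n).choose (n - k) : ℚ)) := by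
  have hk' := mem_Icc.1 hk
  have hsplit : (Icc 1 n).erase k = Icc 1 (k - 1) ∪ Icc (k + 1) n := by
    ext j; simp only [mem_erase, mem_Icc, mem_union]; omega
  have hdisj : Disjoint (Icc 1 (k - 1)) (Icc (k + 1) n) := by
    rw [disjoint_left]; intro j h1 h2; simp only [mem_Icc] at h1 h2; omega
  rw [Wfun, hsplit, prod_union hdisj]
  congr 1
  · rw [prod_Icc_eq_prod_range, prod_range_add_one_add]
  · -- `∏_{j=k+1}^{n}(m+j) = ∏_{i<n−k}((m+k)+1+i) = (n−k)!·binom(m+k+(n−k), n−k)`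
    have e : ∏ j ∈ Icc (k + 1) n, ((m : ℚ) + j) = ∏ i ∈ range (n - k), (((m + k : ℕ) : ℚ) + 1 + i) := by
      rw [← Finset.Ico_add_one_right_eq_Icc, Finset.prod_Ico_eq_prod_range, show n + 1 - (k + 1) = n - k by omega]
      exact prod_congr rfl fun j _ => by push_cast; ring
    rw [e, prod_range_add_one_add, show m + k + (n - k) = m + n by omega]

end Literature.NumberTheory.Irrationality.Lai2025TwoAdic
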